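import Literature.AnabelianGeometry.EtaleTheta.Discharge.Sec1Rmk164ZHatApproximation
import Literature.AnabelianGeometry.EtaleTheta.Discharge.Sec1Rmk164HatClassConjFormulaAtHatTheta
import Literature.AnabelianGeometry.EtaleTheta.ContH1Separated
import Literature.AnabelianGeometry.EtaleTheta.ContH1ZHatPow
import Literature.AnabelianGeometry.EtaleTheta.ProfiniteAbelianZHatPowCongruence
import HarnessLib

/-!
# [EtTh] Remark 1.6.4 (c2) in `Ẑ`-FORM at the profinite theta quotient record: `σ̂·(η̈^Θ)^∧` for EVERY `σ̂ ∈ Π_X`,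
# `â := toZHat σ̂ ∈ Ẑ` — topology-free assembly (piece (Z5b) of abc-iut «RMK164-ZHAT»), proof-only

S. Mochizuki, *The étale theta function …*, Publ. RIMS **45** (2009) [EtTh], Remark 1.6.4 (PRIMS pp. 252–253):
«… we obtain a set of classes `O^×_K̈ · (η̈^Θ)^∧ ∈ H¹(Π_{Ÿ^∧}, Δ_Θ)` on which any `Π_X/Π_{Y^∧} ≅ Ẑ ∋ a` acts via
`(η̈^Θ)^∧ ↦ (η̈^Θ)^∧ − 2a·log(Ü) − (a²/2)·log(q_X) + log(O^×_K̈)` [cf. Proposition 1.5, (iii)]»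
[cite: MochizukiEtTh2009, Rmk 1.6.4 pp.252-253].  The tree's `a ∈ ℤ` form (abc-iut-w6-d081,
`HatTheta.rmk164_c2_int` / `rmk164_c2_int_H1Hat`, `σ̂ = toHat σ`, `σ` tempered) is extended here to ALL `σ̂ ∈ Π_X` with
`â := toZHat σ̂ ∈ Ẑ` (abc-iut-f-142's `ThetaSetting.toZHat`, p511642) and the `Ẑ`-powers `x ↦ x^â` of abc-iut-L2-t12
(`ContH1.zhatPow`, p516186; exponents `−2â := (â·â)⁻¹`, `−â² := (â ⋆ â)⁻¹`, `⋆ = ProfiniteZHatPow.powZHat`).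

abc-iut cell, prover abc-iut-f-128 (gen 8); row «RMK164-ZHAT» (Z5b) (abc-iut-L2-lead gen 9 R1364/R1371/R1387).
PROOF-ONLY: no definition, no instance, no notation, no Prop-valued fact.  METHOD (no topology on `H¹` is used):
for `σ̂ ∈ Π_X` and an open normal `N` of `((Π^tp_X)^Θ)^∧`, (Z4b) gives an open `V ≤ Ẑ` on whose `â`-coset the exponent
maps `ĉ ↦ m^(−2ĉ)`, `ĉ ↦ m^(−ĉ²)` are constant modulo `N` UNIFORMLY in `m ∈ Δ_Θ`
(`ProfiniteZHatPow.forall_zhatPow_negTwo_negSq_congr`, p516225 v2); (Z5a) gives a TEMPERED `σ` with `η(toZ σ)` in that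
coset and `σ̂·x̂ ≡_N toHat(σ)·x̂` at the level of representing cocycles (`HatTheta.exists_tempered_conj_congr`, p514055);
the `a ∈ ℤ` formula at `σ` (abc-iut-w6-d081 p506713) is rewritten in `Ẑ`-powers at `ĉ := η(toZ σ)`
(`ContH1.zhatPow_etaZ`), and the factorwise congruences are multiplied (`ContH1.exists_rep_congr_mul`, p515263).
* `ContH1.exists_rep_congr_refl` / `_trans` / `_zhatPow`, `ContH1.zhatPow_etaZ_sq_inv` / `zhatPow_powZHat_etaZ_self_inv`
  — generic bookkeeping in the representative-congruence currency of `ContH1Separated` v2;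
* `HatTheta.compactSpace_deltaThetaHat` — `ι(Δ_Θ)` is compact (closed in the profinite `((Π^tp_X)^Θ)^∧`), the
  coefficient hypothesis of `ContH1.zhatPow` (a THEOREM; consumers write `haveI := T.compactSpace_deltaThetaHat`);
* `HatTheta.rmk164_c2_zhat_congr` — **(c2) in `Ẑ`-form MODULO EVERY open normal `N`**: for every `σ̂ ∈ Π_X` and `N`
  there is a unit `u ∈ O^×_K̈` with `σ̂·X̂ ≡_N X̂ · L̂^(−2â) · Q̂^(−â²) · Û(u)` (representatives congruent pointwise mod `N`),
  from the `a ∈ ℤ` formula at the tempered elements (displayed hypothesis `hZ`, = the conclusion shape of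
  `HatTheta.rmk164_c2_int`, inhabited under `Prop15iii`);
* `HatTheta.rmk164_c2_zhat` — **(c2) in `Ẑ`-form, EXACT**: `σ̂·X̂ = X̂ · L̂^(−2â) · Q̂^(−â²) · Û(u)` for some unit `u`,
  under the ONE displayed input «the unit classes `{Û(u)}` are congruence-closed» (`hU`; discharged where the Kummer map
  is concrete by abc-iut-f-142's `ContH1.exists_eq_mk_of_forall_exists_rep_congr_family`, row (α)) — by SEPARATEDNESS
  of `H¹` (`ContH1.eq_of_forall_exists_rep_congr` is the currency; here the closedness clause absorbs it);
* `HatTheta.rmk164_c2_zhat_congr_of_prop15iii` — the same with `hZ` DERIVED from `Prop15iii` via w6-d081's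
  `rmk164_c2_int` (hat classes characterised by their pull-backs along `ι`).
HONEST FRAMING: classical cohomological bookkeeping under OUR kernel check; `Prop15iii`, the hat classes and the
closedness clause are DISPLAYED hypotheses; nothing here bears on [IUTchIII] Cor. 3.12; no side taken; typed ≠ proved.
-/

noncomputable section

namespace Literature.AnabelianGeometry.EtaleTheta

open scoped IsMulCommutative
open Topology
open Literature.AnabelianGeometry.SemiGraphs

/-! ### §1. Generic bookkeeping in `H¹(H, A)`: representative congruences and `Ẑ`-exponents at integers -/

namespace ContH1

variable {G G' : Type*} [Group G] [TopologicalSpace G]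
  [Group G'] [TopologicalSpace G'] [IsTopologicalGroup G']
  {φ : G →* G'} {A : Subgroup G'} [A.Normal] [IsMulCommutative A] {H : Subgroup G}

/-- Reflexivity of the representative congruence: a class has two (equal) representatives congruent modulo any `N`.
[cite: NeukirchSchmidtWingberg2008, I §2 and II §7] -/
theorem exists_rep_congr_refl (N : Subgroup G') (x : ContH1 φ A H) :
    ∃ f g : contCocycles φ A H, (QuotientGroup.mk f : ContH1 φ A H) = x ∧ (QuotientGroup.mk g : ContH1 φ A H) = x ∧
      ∀ h : H, ((f.1 h : A) : G') * (((g.1 h : A) : G'))⁻¹ ∈ N := by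
  induction x using QuotientGroup.induction_on with
  | H f => exact ⟨f, f, rfl, rfl, fun h => by rw [mul_inv_cancel]; exact N.one_mem⟩

/-- Transitivity of the representative congruence ACROSS a common middle class (its two representatives differ by a
cocycle of trivial class, which is moved to the far end: `k′ := k·g′⁻¹·g`). [cite: NeukirchSchmidtWingberg2008, I §2 and II §7] -/
theorem exists_rep_congr_trans (N : Subgroup G') {x y z : ContH1 φ A H}
    (h₁ : ∃ f g : contCocycles φ A H, (QuotientGroup.mk f : ContH1 φ A H) = x ∧
      (QuotientGroup.mk g : ContH1 φ A H) = y ∧ ∀ h : H, ((f.1 h : A) : G') * (((g.1 h : A) : G'))⁻¹ ∈ N)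
    (h₂ : ∃ g k : contCocycles φ A H, (QuotientGroup.mk g : ContH1 φ A H) = y ∧
      (QuotientGroup.mk k : ContH1 φ A H) = z ∧ ∀ h : H, ((g.1 h : A) : G') * (((k.1 h : A) : G'))⁻¹ ∈ N) :
    ∃ f k : contCocycles φ A H, (QuotientGroup.mk f : ContH1 φ A H) = x ∧
      (QuotientGroup.mk k : ContH1 φ A H) = z ∧ ∀ h : H, ((f.1 h : A) : G') * (((k.1 h : A) : G'))⁻¹ ∈ N := by
  obtain ⟨f, g, hf, hg, hfg⟩ := h₁
  obtain ⟨g', k, hg', hk, hgk⟩ := h₂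
  refine ⟨f, k * g'⁻¹ * g, hf, ?_, fun h => ?_⟩
  · change (QuotientGroup.mk k : ContH1 φ A H) * ((QuotientGroup.mk g' : ContH1 φ A H))⁻¹ *
        (QuotientGroup.mk g : ContH1 φ A H) = z
    rw [hk, hg', hg, inv_mul_cancel_right]
  · have e : ((f.1 h : A) : G') * ((((k * g'⁻¹ * g).1 h : A) : G'))⁻¹ =
        (((f.1 h : A) : G') * (((g.1 h : A) : G'))⁻¹) * (((g'.1 h : A) : G') * (((k.1 h : A) : G'))⁻¹) := by
      change ((f.1 h : A) : G') * (((k.1 h * (g'.1 h)⁻¹ * g.1 h : A) : G'))⁻¹ = _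
      rw [Subgroup.coe_mul, Subgroup.coe_mul, Subgroup.coe_inv]
      group
    rw [e]
    exact N.mul_mem (hfg h) (hgk h)

variable [CompactSpace A] [TotallyDisconnectedSpace A]

/-- **`Ẑ`-powers with congruent exponents have congruent representatives**: if `m^â ≡ m^b̂ (mod N)` for EVERY `m ∈ A`
(the uniform exponent congruence of `ProfiniteZHatPow.forall_zhatPow_congr`), then `x^â` and `x^b̂` have representing
cocycles congruent pointwise modulo `N` (`x^â = [h ↦ f(h)^â]`, `ContH1.zhatPow_mk`). [cite: RibesZalesskii2010, §4.1] -/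
theorem exists_rep_congr_zhatPow (N : Subgroup G') {a b : ThetaSetting.ZHat}
    (hab : ∀ m : A, ((ProfiniteZHatPow.zhatPow a m : A) : G') * (((ProfiniteZHatPow.zhatPow b m : A) : G'))⁻¹ ∈ N)
    (x : ContH1 φ A H) :
    ∃ f g : contCocycles φ A H, (QuotientGroup.mk f : ContH1 φ A H) = zhatPow φ A H a x ∧
      (QuotientGroup.mk g : ContH1 φ A H) = zhatPow φ A H b x ∧
        ∀ h : H, ((f.1 h : A) : G') * (((g.1 h : A) : G'))⁻¹ ∈ N := by
  induction x using QuotientGroup.induction_on with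
  | H ℓ =>
    exact ⟨⟨fun h => ProfiniteZHatPow.zhatPow a (ℓ.1 h), zhatPow_mem_contCocycles φ A H a ℓ.1 ℓ.2⟩,
      ⟨fun h => ProfiniteZHatPow.zhatPow b (ℓ.1 h), zhatPow_mem_contCocycles φ A H b ℓ.1 ℓ.2⟩, rfl, rfl,
      fun h => hab (ℓ.1 h)⟩

/-- The exponent `−2a` at an integer: `x^((η t · η t)⁻¹) = x^(−2·t)` (`η : ℤ → Ẑ`, `Ẑ` written multiplicatively).
[cite: RibesZalesskii2010, §4.1] -/
theorem zhatPow_etaZ_sq_inv (t : Multiplicative ℤ) (x : ContH1 φ A H) :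
    zhatPow φ A H (ThetaSetting.etaZ t * ThetaSetting.etaZ t)⁻¹ x = x ^ (-(2 * Multiplicative.toAdd t)) := by
  rw [← map_mul, ← map_inv, zhatPow_etaZ, toAdd_inv, toAdd_mul, two_mul]

/-- The exponent `−a²` at an integer: `x^((η t ⋆ η t)⁻¹) = x^(−t·t)` (`⋆ = powZHat`, the ring product of `Ẑ`).
[cite: RibesZalesskii2010, §4.1] -/
theorem zhatPow_powZHat_etaZ_self_inv (t : Multiplicative ℤ) (x : ContH1 φ A H) :
    zhatPow φ A H (ProfiniteZHatPow.powZHat (ThetaSetting.etaZ t) (ThetaSetting.etaZ t))⁻¹ x =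
      x ^ (-(Multiplicative.toAdd t * Multiplicative.toAdd t)) := by
  rw [ProfiniteZHatPow.powZHat_self_etaZ, ← map_zpow, ← map_inv, zhatPow_etaZ, toAdd_inv, toAdd_zpow, smul_eq_mul]

end ContH1

/-! ### §2. [EtTh] Rmk 1.6.4 (c2) in `Ẑ`-form at the record `ThetaSetting.HatTheta` -/

namespace ThetaSetting.HatTheta

variable {p : ℕ} [Fact p.Prime] {D : ThetaSetting p} (T : D.HatTheta)

/-- `ι(Δ_Θ) ≤ ((Π^tp_X)^Θ)^∧` is COMPACT (closed — `isClosed_deltaThetaHat` — in a profinite group): the coefficient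
hypothesis of abc-iut-L2-t12's `ContH1.zhatPow`.  A theorem, not an instance: `haveI := T.compactSpace_deltaThetaHat`.
[cite: MochizukiEtTh2009, §1 p.12] -/
theorem compactSpace_deltaThetaHat : CompactSpace T.DeltaThetaHat :=
  isCompact_iff_compactSpace.mp T.isClosed_deltaThetaHat.isCompact

/-- **[EtTh] Rmk 1.6.4 (c2) in `Ẑ`-form, MODULO EVERY OPEN NORMAL SUBGROUP** (record-generic; the `a ∈ ℤ` formula at the
tempered elements displayed as `hZ` — the conclusion shape of `rmk164_c2_int`): for Θ-hat classes `x̂, L̂, Q̂`, unit hat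
classes `Û(u)`, EVERY `σ̂ ∈ Π_X` with `â := toZHat σ̂` and every open normal `N ⊴ ((Π^tp_X)^Θ)^∧` there is `u ∈ O^×_K̈`
such that `σ̂·infl(x̂)` and `infl(x̂) · infl(L̂)^(−2â) · infl(Q̂)^(−â²) · infl(Û(u))` have representing cocycles
`Π_{Ÿ^∧} → Δ_Θ` congruent pointwise modulo `N` (`−2â := (â·â)⁻¹`, `−â² := (â ⋆ â)⁻¹`).
[cite: MochizukiEtTh2009, Rmk 1.6.4 pp.252-253] -/
theorem rmk164_c2_zhat_congr [T.DeltaThetaHat.Normal] [T.GhatThetaYdd.Normal] [D.GtpYddHat.Normal]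
    [CompactSpace T.DeltaThetaHat]
    (xh Lh Qh : T.H1ThetaHat T.GhatThetaYdd) (Uh : (↥D.Kdd)ˣ → T.H1ThetaHat T.GhatThetaYdd)
    (hZ : ∀ σ : D.PiTemp, ∃ u ∈ D.unitsOKdd,
      ContH1.conj (MonoidHom.id T.GhatTheta) T.DeltaThetaHat (T.ι (D.toTheta σ)) xh =
        xh * Lh ^ (-(2 * Multiplicative.toAdd (D.toZ σ)))
          * Qh ^ (-(Multiplicative.toAdd (D.toZ σ) * Multiplicative.toAdd (D.toZ σ))) * Uh u)
    (σh : D.PiHat) (N : OpenNormalSubgroup T.GhatTheta) :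
    ∃ u ∈ D.unitsOKdd, ∃ f g : contCocycles T.toThetaHat.toMonoidHom T.DeltaThetaHat D.GtpYddHat,
      (QuotientGroup.mk f : T.H1Hat D.GtpYddHat) =
          ContH1.conj T.toThetaHat.toMonoidHom T.DeltaThetaHat σh (T.inflThetaHat xh) ∧
        (QuotientGroup.mk g : T.H1Hat D.GtpYddHat) =
          T.inflThetaHat xh
            * ContH1.zhatPow T.toThetaHat.toMonoidHom T.DeltaThetaHat D.GtpYddHat
                (D.toZHat σh * D.toZHat σh)⁻¹ (T.inflThetaHat Lh)
            * ContH1.zhatPow T.toThetaHat.toMonoidHom T.DeltaThetaHat D.GtpYddHat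
                (ProfiniteZHatPow.powZHat (D.toZHat σh) (D.toZHat σh))⁻¹ (T.inflThetaHat Qh)
            * T.inflThetaHat (Uh u) ∧
        ∀ h : D.GtpYddHat,
          ((f.1 h : T.DeltaThetaHat) : T.GhatTheta) * (((g.1 h : T.DeltaThetaHat) : T.GhatTheta))⁻¹ ∈
            N.toSubgroup := by
  -- (Z4b): an open `V ≤ Ẑ` on whose cosets `m^(−2ĉ)`, `m^(−ĉ²)` are constant modulo `N`, uniformly in `m ∈ ι(Δ_Θ)`
  let UN : Subgroup T.DeltaThetaHat := N.toSubgroup.comap T.DeltaThetaHat.subtype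
  have hUN : IsOpen (UN : Set T.DeltaThetaHat) :=
    N.toOpenSubgroup.isOpen.preimage continuous_subtype_val
  obtain ⟨V, hV⟩ := ProfiniteZHatPow.forall_zhatPow_negTwo_negSq_congr UN hUN
  have hWo : IsOpen {c : ZHat | c * (D.toZHat σh)⁻¹ ∈ V.toSubgroup} :=
    V.toOpenSubgroup.isOpen.preimage (continuous_id.mul continuous_const)
  have haW : D.toZHat σh ∈ {c : ZHat | c * (D.toZHat σh)⁻¹ ∈ V.toSubgroup} := by
    change D.toZHat σh * (D.toZHat σh)⁻¹ ∈ V.toSubgroup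
    rw [mul_inv_cancel]
    exact V.toSubgroup.one_mem
  -- (Z5a): a tempered `σ` with `η(toZ σ)` in the `V`-coset of `â` and `toHat(σ)·X̂ ≡_N σ̂·X̂`
  obtain ⟨σ, hσW, f₁, f₂, hf₁, hf₂, hcongr⟩ := T.exists_tempered_conj_congr (T.inflThetaHat xh) σh N hWo haW
  -- the `a ∈ ℤ` formula at `σ`, inflated, rewritten in `Ẑ`-powers at `ĉ := η(toZ σ)`
  obtain ⟨u, hu, hform⟩ := hZ σ
  have hH1 := T.rmk164_c2_int_H1Hat σ xh Lh Qh (Uh u) _ _ hform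
  rw [← ContH1.zhatPow_etaZ_sq_inv, ← ContH1.zhatPow_powZHat_etaZ_self_inv] at hH1
  have hexp := hV (etaZ (D.toZ σ)) (D.toZHat σh) hσW
  refine ⟨u, hu, ?_⟩
  -- `σ̂·X̂ ≡_N toHat(σ)·X̂ = P(ĉ)` and `P(ĉ) ≡_N P(â)` factorwise
  have h1 : ∃ f g : contCocycles T.toThetaHat.toMonoidHom T.DeltaThetaHat D.GtpYddHat,
      (QuotientGroup.mk f : T.H1Hat D.GtpYddHat) =
          ContH1.conj T.toThetaHat.toMonoidHom T.DeltaThetaHat σh (T.inflThetaHat xh) ∧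
        (QuotientGroup.mk g : T.H1Hat D.GtpYddHat) =
          ContH1.conj T.toThetaHat.toMonoidHom T.DeltaThetaHat (D.toHat σ) (T.inflThetaHat xh) ∧
        ∀ h : D.GtpYddHat,
          ((f.1 h : T.DeltaThetaHat) : T.GhatTheta) * (((g.1 h : T.DeltaThetaHat) : T.GhatTheta))⁻¹ ∈
            N.toSubgroup := by
    refine ⟨f₂, f₁, hf₂, hf₁, fun h => ?_⟩
    have := N.toSubgroup.inv_mem (hcongr h)
    rwa [mul_inv_rev, inv_inv] at this
  rw [hH1] at h1
  refine ContH1.exists_rep_congr_trans N.toSubgroup h1 ?_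
  refine ContH1.exists_rep_congr_mul N.toSubgroup
    (ContH1.exists_rep_congr_mul N.toSubgroup
      (ContH1.exists_rep_congr_mul N.toSubgroup (ContH1.exists_rep_congr_refl N.toSubgroup (T.inflThetaHat xh))
        (ContH1.exists_rep_congr_zhatPow N.toSubgroup (fun m => ?_) (T.inflThetaHat Lh)))
      (ContH1.exists_rep_congr_zhatPow N.toSubgroup (fun m => ?_) (T.inflThetaHat Qh)))
    (ContH1.exists_rep_congr_refl N.toSubgroup (T.inflThetaHat (Uh u)))
  · exact Subgroup.mem_comap.mp (hexp m).1
  · exact Subgroup.mem_comap.mp (hexp m).2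

/-- **[EtTh] Rmk 1.6.4 (c2) in `Ẑ`-form, EXACT** — «any `Π_X/Π_{Y^∧} ≅ Ẑ ∋ a` acts via
`(η̈^Θ)^∧ ↦ (η̈^Θ)^∧ − 2a·log(Ü) − (a²/2)·log(q_X) + log(O^×_K̈)`»: for EVERY `σ̂ ∈ Π_X`, `â := toZHat σ̂`, there is a unit
`u ∈ O^×_K̈` with `σ̂·infl(x̂) = infl(x̂) · infl(L̂)^(−2â) · infl(Q̂)^(−â²) · infl(Û(u))` in `H¹(Π_{Ÿ^∧}, Δ_Θ)`, under the one
displayed input `hU` «the unit classes `infl(Û(u))`, `u ∈ O^×_K̈`, are CONGRUENCE-CLOSED» (a class congruent modulo every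
`N` to some unit class IS a unit class; abc-iut-f-142 row (α) where the Kummer map is concrete).  Separatedness of `H¹`
(`ContH1.eq_of_forall_exists_rep_congr`) is built into that clause. [cite: MochizukiEtTh2009, Rmk 1.6.4 pp.252-253] -/
theorem rmk164_c2_zhat [T.DeltaThetaHat.Normal] [T.GhatThetaYdd.Normal] [D.GtpYddHat.Normal]
    [CompactSpace T.DeltaThetaHat]
    (xh Lh Qh : T.H1ThetaHat T.GhatThetaYdd) (Uh : (↥D.Kdd)ˣ → T.H1ThetaHat T.GhatThetaYdd)
    (hZ : ∀ σ : D.PiTemp, ∃ u ∈ D.unitsOKdd,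
      ContH1.conj (MonoidHom.id T.GhatTheta) T.DeltaThetaHat (T.ι (D.toTheta σ)) xh =
        xh * Lh ^ (-(2 * Multiplicative.toAdd (D.toZ σ)))
          * Qh ^ (-(Multiplicative.toAdd (D.toZ σ) * Multiplicative.toAdd (D.toZ σ))) * Uh u)
    (hU : ∀ y : T.H1Hat D.GtpYddHat,
      (∀ N : OpenNormalSubgroup T.GhatTheta, ∃ u ∈ D.unitsOKdd,
        ∃ f g : contCocycles T.toThetaHat.toMonoidHom T.DeltaThetaHat D.GtpYddHat,
          (QuotientGroup.mk f : T.H1Hat D.GtpYddHat) = y ∧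
            (QuotientGroup.mk g : T.H1Hat D.GtpYddHat) = T.inflThetaHat (Uh u) ∧
            ∀ h : D.GtpYddHat,
              ((f.1 h : T.DeltaThetaHat) : T.GhatTheta) * (((g.1 h : T.DeltaThetaHat) : T.GhatTheta))⁻¹ ∈
                N.toSubgroup) →
      ∃ u ∈ D.unitsOKdd, y = T.inflThetaHat (Uh u))
    (σh : D.PiHat) :
    ∃ u ∈ D.unitsOKdd,
      ContH1.conj T.toThetaHat.toMonoidHom T.DeltaThetaHat σh (T.inflThetaHat xh) =
        T.inflThetaHat xh
          * ContH1.zhatPow T.toThetaHat.toMonoidHom T.DeltaThetaHat D.GtpYddHat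
              (D.toZHat σh * D.toZHat σh)⁻¹ (T.inflThetaHat Lh)
          * ContH1.zhatPow T.toThetaHat.toMonoidHom T.DeltaThetaHat D.GtpYddHat
              (ProfiniteZHatPow.powZHat (D.toZHat σh) (D.toZHat σh))⁻¹ (T.inflThetaHat Qh)
          * T.inflThetaHat (Uh u) := by
  -- `y := σ̂·X̂ · P⁻¹` with `P := X̂ · L̂^(−2â) · Q̂^(−â²)` is congruent modulo every `N` to a unit class
  obtain ⟨u, hu, hy⟩ := hU
    (ContH1.conj T.toThetaHat.toMonoidHom T.DeltaThetaHat σh (T.inflThetaHat xh) *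
      (T.inflThetaHat xh
        * ContH1.zhatPow T.toThetaHat.toMonoidHom T.DeltaThetaHat D.GtpYddHat
            (D.toZHat σh * D.toZHat σh)⁻¹ (T.inflThetaHat Lh)
        * ContH1.zhatPow T.toThetaHat.toMonoidHom T.DeltaThetaHat D.GtpYddHat
            (ProfiniteZHatPow.powZHat (D.toZHat σh) (D.toZHat σh))⁻¹ (T.inflThetaHat Qh))⁻¹) (fun N => by
      obtain ⟨u, hu, hfg⟩ := T.rmk164_c2_zhat_congr xh Lh Qh Uh hZ σh N
      refine ⟨u, hu, ?_⟩
      have hmul := ContH1.exists_rep_congr_mul N.toSubgroup hfg (ContH1.exists_rep_congr_refl N.toSubgroup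
        (T.inflThetaHat xh
          * ContH1.zhatPow T.toThetaHat.toMonoidHom T.DeltaThetaHat D.GtpYddHat
              (D.toZHat σh * D.toZHat σh)⁻¹ (T.inflThetaHat Lh)
          * ContH1.zhatPow T.toThetaHat.toMonoidHom T.DeltaThetaHat D.GtpYddHat
              (ProfiniteZHatPow.powZHat (D.toZHat σh) (D.toZHat σh))⁻¹ (T.inflThetaHat Qh))⁻¹)
      rwa [mul_inv_cancel_comm] at hmul)
  refine ⟨u, hu, ?_⟩
  rw [mul_inv_eq_iff_eq_mul] at hy
  rw [hy, mul_comm]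

/-- **(c2) in `Ẑ`-form modulo every `N`, with the `a ∈ ℤ` input DERIVED from `Prop15iii`** (abc-iut-w6-d081's
`rmk164_c2_int`: hat classes `x̂, L̂, Q̂, Û(u)` characterised by their pull-backs along `ι` to `ι_* x′`, `ι_* log(Ü)`,
`ι_* kum(q̈)`, `ι_* kum(u)`; `x ∈ O^×_K̈·η̈^Θ`, `x′` its Θ-class). [cite: MochizukiEtTh2009, Rmk 1.6.4 pp.252-253] -/
theorem rmk164_c2_zhat_congr_of_prop15iii [T.DeltaThetaHat.Normal] [T.GhatThetaYdd.Normal] [D.GtpYddHat.Normal]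
    [CompactSpace T.DeltaThetaHat] (hC : D.Compat) (E : D.EtaleThetaData) (h15 : Prop15iii E hC)
    {x : D.H1 D.GtpYdd} (hx : x ∈ E.thetaClasses) :
    ∃ x' : D.H1Theta (D.GtpYdd.map D.toTheta), D.inflTheta D.GtpYdd x' = x ∧
      ∀ (xh Lh Qh : T.H1ThetaHat T.GhatThetaYdd) (Uh : (↥D.Kdd)ˣ → T.H1ThetaHat T.GhatThetaYdd),
        ContH1.comap (MonoidHom.id T.GhatTheta) T.DeltaThetaHat T.ι.toMonoidHom T.ι.continuous
            T.map_ι_gtpYddTheta_le_ghatThetaYdd xh =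
          ContH1.mapCoeff (MonoidHom.id D.GtpTheta) D.DeltaTheta T.ι.toMonoidHom T.ι.continuous T.DeltaThetaHat le_rfl
            (D.GtpYdd.map D.toTheta) x' →
        ContH1.comap (MonoidHom.id T.GhatTheta) T.DeltaThetaHat T.ι.toMonoidHom T.ι.continuous
            T.map_ι_gtpYddTheta_le_ghatThetaYdd Lh =
          ContH1.mapCoeff (MonoidHom.id D.GtpTheta) D.DeltaTheta T.ι.toMonoidHom T.ι.continuous T.DeltaThetaHat le_rfl
            (D.GtpYdd.map D.toTheta) E.logUdd →
        ContH1.comap (MonoidHom.id T.GhatTheta) T.DeltaThetaHat T.ι.toMonoidHom T.ι.continuous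
            T.map_ι_gtpYddTheta_le_ghatThetaYdd Qh =
          ContH1.mapCoeff (MonoidHom.id D.GtpTheta) D.DeltaTheta T.ι.toMonoidHom T.ι.continuous T.DeltaThetaHat le_rfl
            (D.GtpYdd.map D.toTheta) (E.kumYdd (E.toKddHat D.qddUnit)) →
        (∀ u ∈ D.unitsOKdd,
          ContH1.comap (MonoidHom.id T.GhatTheta) T.DeltaThetaHat T.ι.toMonoidHom T.ι.continuous
              T.map_ι_gtpYddTheta_le_ghatThetaYdd (Uh u) =
            ContH1.mapCoeff (MonoidHom.id D.GtpTheta) D.DeltaTheta T.ι.toMonoidHom T.ι.continuous T.DeltaThetaHat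
              le_rfl (D.GtpYdd.map D.toTheta) (E.kumYdd (E.toKddHat u))) →
        ∀ (σh : D.PiHat) (N : OpenNormalSubgroup T.GhatTheta),
          ∃ u ∈ D.unitsOKdd, ∃ f g : contCocycles T.toThetaHat.toMonoidHom T.DeltaThetaHat D.GtpYddHat,
            (QuotientGroup.mk f : T.H1Hat D.GtpYddHat) =
                ContH1.conj T.toThetaHat.toMonoidHom T.DeltaThetaHat σh (T.inflThetaHat xh) ∧
              (QuotientGroup.mk g : T.H1Hat D.GtpYddHat) =
                T.inflThetaHat xh
                  * ContH1.zhatPow T.toThetaHat.toMonoidHom T.DeltaThetaHat D.GtpYddHat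
                      (D.toZHat σh * D.toZHat σh)⁻¹ (T.inflThetaHat Lh)
                  * ContH1.zhatPow T.toThetaHat.toMonoidHom T.DeltaThetaHat D.GtpYddHat
                      (ProfiniteZHatPow.powZHat (D.toZHat σh) (D.toZHat σh))⁻¹ (T.inflThetaHat Qh)
                  * T.inflThetaHat (Uh u) ∧
              ∀ h : D.GtpYddHat,
                ((f.1 h : T.DeltaThetaHat) : T.GhatTheta) * (((g.1 h : T.DeltaThetaHat) : T.GhatTheta))⁻¹ ∈
                  N.toSubgroup := by
  obtain ⟨x', hx', hall⟩ := T.rmk164_c2_int hC E h15 hx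
  refine ⟨x', hx', fun xh Lh Qh Uh hxh hLh hQh hUh σh N => ?_⟩
  refine T.rmk164_c2_zhat_congr xh Lh Qh Uh (fun σ => ?_) σh N
  obtain ⟨u, hu, hσ⟩ := hall xh Lh Qh hxh hLh hQh σ
  exact ⟨u, hu, hσ (Uh u) (hUh u hu)⟩

end ThetaSetting.HatTheta

end Literature.AnabelianGeometry.EtaleTheta

end
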